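import Summits.ValiantsHypothesis.ValiantsHypothesis.Theorems.LacunarySymmetroidMatrixDescartesCensusDoorA34NineInertiaChamberII
import Mathlib.Analysis.Matrix.Spectrum

/-!
# `MatrixDescartes` census — DOOR A at `(3,4)`: the CHAMBER-II ONE-CROSSING LAW for ARBITRARY symmetric letters (log-slope form, kernel)

HONEST FRAMING.  Object-search cell `pub-symmetroid`, door-A seat `val-sym-door-p3` (g16); helper file beside the OPEN typed statement
`DoorA34 = PosRootLawAt 3 4 18` (route item `Theses.LacunarySymmetroid.DoorA34`, stmt-ValiantsHypothesis-19980), asserted nowhere here.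
Companion of `…NineInertiaChamberII` (arithmetic core `NineInertia.chamberII_core`).  Here the law is proved for ANY real symmetric middle letter `A`:

**`chamberII_logSlope`** — if `A` is real symmetric `3 × 3` with `det A > 0`, `tr adj A > 0`, `tr A < 0` (the chamber-II sign data of the middle letter of a
nine-row with positive definite bottom letter, `NineInertia.signs_chamber_II` at `S₀ = 1`), `B` is any real `3 × 3` matrix with `tr B < 0` and
`tr A·tr B − tr(A B) < 0` (two more of those signs), `u > 0`, and `x` is a unit bottom eigenvector of `A + uB` — `(A + uB)x = t x` and `t|y|² ≤ σ_{A+uB}(y)`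
for all `y` — then `2u·σ_B(x) < −t`: the log-slope of the bottom eigen-branch of `A + uB` exceeds `−1/2`.  Proof: orthogonal diagonalisation of `A`
(Mathlib's spectral theorem), the label-free diagonal case `chamberII_logSlope_diag_idx`, and the sign pattern of the eigenvalues
(`exists_signPattern_of_invariants`: `det > 0`, `e₂ > 0`, `tr < 0` ⇒ one positive eigenvalue smaller than both absolute negative ones).

Paper consequence (report DOOR-A34-P3G16 §5): on a chamber-II support (`2d₁ < d₂ < 3d₁`, `β = d₁/(d₂−d₁) ∈ (1/2,1)`) a `(3,3)` nine-row with positive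
definite bottom letter has EXACTLY ONE λ_min-crossing (never the flag ladder's pure-λ_min source) — the one-variable monotonicity step is not typed.
Nothing here bounds `ζ_sym(3,3)` or `ζ_sym(3,4)`; `DoorA34`, Claim L (chambers III/IV) and `MatrixDescartes` (stmt-ValiantsHypothesis-18050) stay OPEN;
nothing on `VP ≠ VNP`.
[folklore] Spectral theorem for real symmetric matrices; Rayleigh quotients; elementary.
-/

open Finset Matrix

-- `Summit.ValiantsHypothesis.ValiantsHypothesis.…` repeats a component by the D-0017 layout
-- (single-conjunct summit), which the `dupNamespace` linter flags; the name is mandated.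
set_option linter.dupNamespace false

namespace Summit.ValiantsHypothesis.ValiantsHypothesis.Theorems.LacunarySymmetroidMatrixDescartes.Census

namespace NineInertia

open scoped BigOperators Matrix

/-! ## 1. Label-free bookkeeping on `Fin 3` -/

/-- A sum over `Fin 3` written along any three pairwise distinct indices. [folklore] -/
theorem sum_three_of_distinct (f : Fin 3 → ℝ) {i j k : Fin 3} (hij : i ≠ j) (hik : i ≠ k) (hjk : j ≠ k) :
    ∑ l, f l = f i + f j + f k := by
  fin_cases i <;> fin_cases j <;> fin_cases k <;> simp_all [Fin.sum_univ_three] <;> ring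

/-- Rayleigh bound at a coordinate vector (label-free): `t|e_i|² ≤ σ_{diag α + uB}(e_i)` gives `t ≤ α i + u B i i`. [folklore] -/
theorem rayleigh_coord (α : Fin 3 → ℝ) (B : Matrix (Fin 3) (Fin 3) ℝ) (u t : ℝ)
    (hmin : ∀ y : Fin 3 → ℝ, t * (y ⬝ᵥ y) ≤ y ⬝ᵥ (Matrix.diagonal α + u • B) *ᵥ y) (i : Fin 3) :
    t ≤ α i + u * B i i := by
  obtain ⟨h0, h1, h2⟩ := rayleigh_coord_three α B u t hmin
  fin_cases i
  · exact h0
  · exact h1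
  · exact h2

/-! ## 2. The diagonal law with arbitrary labels -/

/-- **The chamber-II law for a diagonal middle letter, label-free**: indices `i₀, j₁, j₂` pairwise distinct with `α i₀ > 0 > α j₁ ≥ α j₂` and
`α i₀ < −α j₁`; `tr B < 0`, `tr(diag α)·tr B − tr(diag α · B) < 0`; bottom eigenpair `(t, x)` of `diag α + uB` (`u > 0`) ⇒ `2u·σ_B(x) < −t`. [folklore] -/
theorem chamberII_logSlope_diag_idx (α : Fin 3 → ℝ) (B : Matrix (Fin 3) (Fin 3) ℝ) {i₀ j₁ j₂ : Fin 3}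
    (h01 : i₀ ≠ j₁) (h02 : i₀ ≠ j₂) (h12 : j₁ ≠ j₂)
    (hp : 0 < α i₀) (hq : α j₁ < 0) (hqr : α j₂ ≤ α j₁) (hpq : α i₀ < -α j₁)
    (htrB : B.trace < 0) (hMX : (Matrix.diagonal α).trace * B.trace - (Matrix.diagonal α * B).trace < 0)
    {u t : ℝ} (hu : 0 < u) {x : Fin 3 → ℝ} (hx1 : x ⬝ᵥ x = 1)
    (heig : (Matrix.diagonal α + u • B) *ᵥ x = t • x)
    (hmin : ∀ y : Fin 3 → ℝ, t * (y ⬝ᵥ y) ≤ y ⬝ᵥ (Matrix.diagonal α + u • B) *ᵥ y) :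
    2 * (u * (x ⬝ᵥ B *ᵥ x)) < -t := by
  have r := rayleigh_coord α B u t hmin
  -- traces along (i₀, j₁, j₂)
  have htr : B.trace = B i₀ i₀ + B j₁ j₁ + B j₂ j₂ := by
    unfold Matrix.trace
    exact sum_three_of_distinct (fun l => B.diag l) h01 h02 h12
  have htrAB : (Matrix.diagonal α * B).trace = α i₀ * B i₀ i₀ + α j₁ * B j₁ j₁ + α j₂ * B j₂ j₂ := by
    unfold Matrix.trace
    rw [sum_three_of_distinct (fun l => (Matrix.diagonal α * B).diag l) h01 h02 h12]
    simp [Matrix.diagonal_mul]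
  have htrA : (Matrix.diagonal α).trace = α i₀ + α j₁ + α j₂ := by
    unfold Matrix.trace
    rw [sum_three_of_distinct (fun l => (Matrix.diagonal α).diag l) h01 h02 h12]
    simp [Matrix.diagonal]
  rw [htr, htrAB, htrA] at hMX
  rw [htr] at htrB
  -- Rayleigh data of the eigenvector
  set a : ℝ := x ⬝ᵥ Matrix.diagonal α *ᵥ x with ha_def
  set b : ℝ := x ⬝ᵥ B *ᵥ x with hb_def
  have htab : t = a + u * b := by
    have h := congrArg (fun v => x ⬝ᵥ v) heig
    simp only [Matrix.add_mulVec, Matrix.smul_mulVec, dotProduct_add, dotProduct_smul, smul_eq_mul, hx1, mul_one] at h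
    linarith
  have ha : -(-α j₂) ≤ a := by
    rw [neg_neg]
    -- a - α j₂ = Σ (α l - α j₂) x_l² ≥ 0
    have hexp : a = ∑ l, α l * (x l * x l) := by
      simp [ha_def, dotProduct, Matrix.mulVec_diagonal]; exact Finset.sum_congr rfl fun l _ => by ring
    have hx : ∑ l, x l * x l = 1 := by simpa [dotProduct] using hx1
    have hle : ∀ l, α j₂ ≤ α l := by
      intro l
      by_cases hl0 : l = i₀
      · rw [hl0]; linarith
      by_cases hl1 : l = j₁
      · rw [hl1]; exact hqr
      have hl2 : l = j₂ := by
        fin_cases l <;> fin_cases i₀ <;> fin_cases j₁ <;> fin_cases j₂ <;> simp_all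
      rw [hl2]
    have key : α j₂ * ∑ l, x l * x l ≤ ∑ l, α l * (x l * x l) := by
      rw [Finset.mul_sum]
      exact Finset.sum_le_sum fun l _ => mul_le_mul_of_nonneg_right (hle l) (mul_self_nonneg (x l))
    rw [hx, mul_one] at key
    linarith
  have key := chamberII_core (p := α i₀) (q := -α j₁) (r := -α j₂) (u := u) (t := t) (a := a) (b := b)
    (b₁₁ := B i₀ i₀) (b₂₂ := B j₁ j₁) (b₃₃ := B j₂ j₂) hp (by linarith) (by linarith) hpq (by linarith) (by nlinarith) hu
    (by have := r j₂; linarith) (by have := r j₁; linarith) ha htab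
  simpa [hb_def] using key

/-! ## 3. The sign pattern of the eigenvalues from `det > 0`, `e₂ > 0`, `tr < 0` -/

/-- Sign bookkeeping: `p q r` with `pqr > 0`, `pq + pr + qr > 0`, `p + q + r < 0` and `p > 0` force `q, r < 0` and `p < −q`, `p < −r`. [folklore] -/
theorem signPattern_aux {p q r : ℝ} (h3 : 0 < p * q * r) (h2 : 0 < p * q + p * r + q * r) (h1 : p + q + r < 0) (hp : 0 < p) :
    q < 0 ∧ r < 0 ∧ p < -q ∧ p < -r := by
  have hqr : 0 < q * r := by
    have : 0 < p * (q * r) := by rw [← mul_assoc]; exact h3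
    exact pos_of_mul_pos_right this hp.le
  have hq : q < 0 := by
    by_contra hq; push Not at hq
    rcases hq.lt_or_eq with hq' | hq'
    · have hr : 0 < r := pos_of_mul_pos_right hqr hq'.le
      linarith
    · rw [← hq'] at hqr; simp at hqr
  have hr : r < 0 := by nlinarith
  refine ⟨hq, hr, ?_, ?_⟩
  · by_contra H; push Not at H
    nlinarith [mul_nonneg (by linarith : (0:ℝ) ≤ p + q) (by linarith : (0:ℝ) ≤ -(q + r))]
  · by_contra H; push Not at H
    nlinarith [mul_nonneg (by linarith : (0:ℝ) ≤ p + r) (by linarith : (0:ℝ) ≤ -(q + r))]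

/-- Three reals (indexed by `Fin 3`) with positive product, positive second symmetric function and negative sum are one positive `α i₀` and two
negatives `α j₂ ≤ α j₁ < 0` with `α i₀ < −α j₁` (the eigenvalue pattern of a chamber-II middle letter). [folklore] -/
theorem exists_signPattern_of_invariants (α : Fin 3 → ℝ) (hdet : 0 < α 0 * α 1 * α 2)
    (he2 : 0 < α 0 * α 1 + α 0 * α 2 + α 1 * α 2) (htr : α 0 + α 1 + α 2 < 0) :
    ∃ i₀ j₁ j₂ : Fin 3, i₀ ≠ j₁ ∧ i₀ ≠ j₂ ∧ j₁ ≠ j₂ ∧ 0 < α i₀ ∧ α j₁ < 0 ∧ α j₂ ≤ α j₁ ∧ α i₀ < -α j₁ := by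
  rcases lt_or_ge 0 (α 0) with h0 | h0
  · obtain ⟨h1, h2, h01, h02⟩ := signPattern_aux hdet he2 htr h0
    rcases le_total (α 2) (α 1) with h | h
    · exact ⟨0, 1, 2, by decide, by decide, by decide, h0, h1, h, h01⟩
    · exact ⟨0, 2, 1, by decide, by decide, by decide, h0, h2, h, h02⟩
  rcases lt_or_ge 0 (α 1) with h1 | h1
  · obtain ⟨h0', h2, h10, h12⟩ := signPattern_aux (p := α 1) (q := α 0) (r := α 2) (by linarith [hdet]) (by linarith [he2]) (by linarith) h1
    rcases le_total (α 2) (α 0) with h | h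
    · exact ⟨1, 0, 2, by decide, by decide, by decide, h1, h0', h, h10⟩
    · exact ⟨1, 2, 0, by decide, by decide, by decide, h1, h2, h, h12⟩
  · have h0' : α 0 < 0 := lt_of_le_of_ne h0 (fun h => by rw [h] at hdet; simp at hdet)
    have h1' : α 1 < 0 := lt_of_le_of_ne h1 (fun h => by rw [h] at hdet; simp at hdet)
    have h2 : 0 < α 2 := by
      have h01 : 0 < α 0 * α 1 := mul_pos_of_neg_of_neg h0' h1'
      exact pos_of_mul_pos_right hdet h01.le
    obtain ⟨-, -, h20, h21⟩ := signPattern_aux (p := α 2) (q := α 0) (r := α 1) (by linarith [hdet]) (by linarith [he2]) (by linarith) h2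
    rcases le_total (α 1) (α 0) with h | h
    · exact ⟨2, 0, 1, by decide, by decide, by decide, h2, h0', h, h20⟩
    · exact ⟨2, 1, 0, by decide, by decide, by decide, h2, h1', h, h21⟩

/-! ## 4. Conjugation bookkeeping and the law for arbitrary symmetric `A` -/

/-- `(U v)·(M (U w)) = v·((Uᵀ M U) w)`. [folklore] -/
theorem dotProduct_conj (U M : Matrix (Fin 3) (Fin 3) ℝ) (v w : Fin 3 → ℝ) :
    (U *ᵥ v) ⬝ᵥ (M *ᵥ (U *ᵥ w)) = v ⬝ᵥ ((Uᵀ * M * U) *ᵥ w) := by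
  rw [dotProduct_mulVec, vecMul_mulVec, ← dotProduct_mulVec, Matrix.mulVec_mulVec]

/-- `tr adj A = ((tr A)² − tr(A²))/2` for `3 × 3` matrices. [folklore] -/
theorem trace_adjugate_fin_three (A : Matrix (Fin 3) (Fin 3) ℝ) :
    A.adjugate.trace = (A.trace ^ 2 - (A * A).trace) / 2 := by
  simp only [Matrix.trace_fin_three, Matrix.adjugate_fin_three, Matrix.mul_apply, Fin.sum_univ_three, Matrix.of_apply,
    Matrix.cons_val', Matrix.cons_val_zero, Matrix.cons_val_one, Matrix.cons_val_two, Matrix.empty_val', Matrix.cons_val_fin_one,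
    Matrix.head_cons, Matrix.tail_cons, Matrix.head_fin_const]
  ring

/-- **THE CHAMBER-II ONE-CROSSING LAW, log-slope form, arbitrary symmetric middle letter.**  `A` real symmetric `3 × 3` with `det A > 0`,
`tr adj A > 0`, `tr A < 0`; `B` real with `tr B < 0` and `tr A·tr B − tr(AB) < 0`; `u > 0`; `x` a unit bottom eigenvector of `A + uB`
(`(A + uB)x = t x`, `t|y|² ≤ σ_{A+uB}(y)` for all `y`).  Then `2u·σ_B(x) < −t`. [folklore] -/
theorem chamberII_logSlope {A B : Matrix (Fin 3) (Fin 3) ℝ} (hA : A.IsSymm)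
    (hdet : 0 < A.det) (he2 : 0 < A.adjugate.trace) (htr : A.trace < 0)
    (htrB : B.trace < 0) (hMX : A.trace * B.trace - (A * B).trace < 0)
    {u t : ℝ} (hu : 0 < u) {x : Fin 3 → ℝ} (hx1 : x ⬝ᵥ x = 1)
    (heig : (A + u • B) *ᵥ x = t • x)
    (hmin : ∀ y : Fin 3 → ℝ, t * (y ⬝ᵥ y) ≤ y ⬝ᵥ (A + u • B) *ᵥ y) :
    2 * (u * (x ⬝ᵥ B *ᵥ x)) < -t := by
  have hH : A.IsHermitian := Matrix.isHermitian_iff_isSymm.2 hA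
  set U : Matrix (Fin 3) (Fin 3) ℝ := (hH.eigenvectorUnitary : Matrix (Fin 3) (Fin 3) ℝ) with hUdef
  set e : Fin 3 → ℝ := hH.eigenvalues with he
  have hAeq : A = U * Matrix.diagonal e * star U := by
    simpa [Unitary.conjStarAlgAut_apply, hUdef, he] using hH.spectral_theorem
  have hstar : star U = Uᵀ := by
    rw [Matrix.star_eq_conjTranspose, Matrix.conjTranspose_eq_transpose_of_trivial]
  have hVU : Uᵀ * U = 1 := by rw [← hstar]; exact Unitary.coe_star_mul_self _
  have hUV : U * Uᵀ = 1 := by rw [← hstar]; exact Unitary.coe_mul_star_self _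
  rw [hstar] at hAeq
  -- the diagonalised data
  set D : Matrix (Fin 3) (Fin 3) ℝ := Matrix.diagonal e with hD
  set B' : Matrix (Fin 3) (Fin 3) ℝ := Uᵀ * B * U with hB'
  set x' : Fin 3 → ℝ := Uᵀ *ᵥ x with hx'
  have hDconj : Uᵀ * A * U = D := by
    rw [hAeq]
    calc Uᵀ * (U * D * Uᵀ) * U = (Uᵀ * U) * D * (Uᵀ * U) := by simp only [Matrix.mul_assoc]
      _ = D := by rw [hVU, Matrix.one_mul, Matrix.mul_one]
  have hMconj : Uᵀ * (A + u • B) * U = D + u • B' := by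
    rw [Matrix.mul_add, Matrix.add_mul, hDconj, Matrix.mul_smul, Matrix.smul_mul, hB']
  have hUx' : U *ᵥ x' = x := by rw [hx', Matrix.mulVec_mulVec, hUV, Matrix.one_mulVec]
  -- eigen-equation for (D + uB', x')
  have heig' : (D + u • B') *ᵥ x' = t • x' := by
    rw [← hMconj, ← Matrix.mulVec_mulVec, ← Matrix.mulVec_mulVec, hUx', heig, Matrix.mulVec_smul]
  -- norm and Rayleigh transfer
  have hx1' : x' ⬝ᵥ x' = 1 := by
    have h := dotProduct_conj U 1 x' x'
    rw [Matrix.one_mulVec, hUx', Matrix.mul_one, hVU, Matrix.one_mulVec] at h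
    rw [← h, hx1]
  have hmin' : ∀ y : Fin 3 → ℝ, t * (y ⬝ᵥ y) ≤ y ⬝ᵥ (D + u • B') *ᵥ y := by
    intro y
    have h := hmin (U *ᵥ y)
    have hn : (U *ᵥ y) ⬝ᵥ (U *ᵥ y) = y ⬝ᵥ y := by
      have h2 := dotProduct_conj U 1 y y
      rw [Matrix.one_mulVec, Matrix.mul_one, hVU, Matrix.one_mulVec] at h2
      exact h2
    rw [hn, dotProduct_conj, hMconj] at h
    exact h
  -- invariants of the diagonal letter
  have htrB' : B'.trace < 0 := by
    rw [hB', Matrix.trace_mul_cycle, hUV, Matrix.one_mul]; exact htrB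
  have htrD : D.trace = A.trace := by
    rw [← hDconj, Matrix.trace_mul_cycle, hUV, Matrix.one_mul]
  have htrDB' : (D * B').trace = (A * B).trace := by
    rw [← hDconj, hB']
    calc (Uᵀ * A * U * (Uᵀ * B * U)).trace = (Uᵀ * (A * (U * Uᵀ) * B) * U).trace := by simp only [Matrix.mul_assoc]
      _ = (A * B).trace := by rw [hUV, Matrix.mul_one, Matrix.trace_mul_cycle, hUV, Matrix.one_mul]
  have hMX' : D.trace * B'.trace - (D * B').trace < 0 := by
    rw [htrD, htrDB', hB', Matrix.trace_mul_cycle, hUV, Matrix.one_mul]; exact hMX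
  -- eigenvalue sign pattern from det, e₂, tr
  have hdetE : 0 < e 0 * e 1 * e 2 := by
    have h := hH.det_eq_prod_eigenvalues
    simp only [Fin.prod_univ_three, RCLike.ofReal_real_eq_id, id_eq] at h
    rw [h] at hdet; simpa [he, mul_assoc] using hdet
  have htrE : e 0 + e 1 + e 2 < 0 := by
    have h : A.trace = e 0 + e 1 + e 2 := by
      rw [← htrD, hD, Matrix.trace_fin_three]; simp [Matrix.diagonal]
    linarith
  have he2E : 0 < e 0 * e 1 + e 0 * e 2 + e 1 * e 2 := by
    have h1 := trace_adjugate_fin_three A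
    have hAA : (A * A).trace = (D * D).trace := by
      rw [← hDconj]
      calc (A * A).trace = (A * (U * Uᵀ) * A * (U * Uᵀ)).trace := by rw [hUV, Matrix.mul_one, Matrix.mul_one]
        _ = (Uᵀ * A * U * (Uᵀ * A * U)).trace := by
          rw [show A * (U * Uᵀ) * A * (U * Uᵀ) = (A * U * Uᵀ * A * U) * Uᵀ by simp only [Matrix.mul_assoc],
            Matrix.trace_mul_comm]
          simp only [Matrix.mul_assoc]
    have hDD : (D * D).trace = e 0 * e 0 + e 1 * e 1 + e 2 * e 2 := by
      rw [hD, Matrix.diagonal_mul_diagonal, Matrix.trace_fin_three]; simp [Matrix.diagonal]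
    have htrA3 : A.trace = e 0 + e 1 + e 2 := by
      rw [← htrD, hD, Matrix.trace_fin_three]; simp [Matrix.diagonal]
    rw [hAA, hDD, htrA3] at h1
    rw [h1] at he2
    nlinarith
  obtain ⟨i₀, j₁, j₂, h01, h02, h12, hp, hq, hqr, hpq⟩ := exists_signPattern_of_invariants e hdetE he2E htrE
  have key := chamberII_logSlope_diag_idx e B' h01 h02 h12 hp hq hqr hpq htrB' (by rw [← hD]; exact hMX') hu hx1'
    (by rw [← hD]; exact heig') (by rw [← hD]; exact hmin')
  -- σ_{B'}(x') = σ_B(x)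
  have hσ : x' ⬝ᵥ B' *ᵥ x' = x ⬝ᵥ B *ᵥ x := by
    have h := dotProduct_conj U B x' x'
    rw [hUx', ← hB'] at h
    exact h.symm
  rw [hσ] at key
  exact key

/-! ## 5. The law for a chamber-II NINE-ROW with bottom letter `1` (appended) -/

/-- Polarisation of the `3 × 3` adjugate at the identity: `adj(1 + A) − adj 1 − adj A = (tr A)·1 − A`. [folklore] -/
theorem adjugate_polar_one_fin_three (A : Matrix (Fin 3) (Fin 3) ℝ) :
    (1 + A).adjugate - (1 : Matrix (Fin 3) (Fin 3) ℝ).adjugate - A.adjugate = A.trace • (1 : Matrix (Fin 3) (Fin 3) ℝ) - A := by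
  ext i j
  fin_cases i <;> fin_cases j <;>
    simp [Matrix.adjugate_fin_three, Matrix.trace_fin_three, Matrix.add_apply, Matrix.sub_apply,
      Matrix.smul_apply] <;> ring

/-- **CHAMBER-II ONE-CROSSING LAW for a nine-row (kernel form).**  Let `1 + X^{d₁} S₁ + X^{d₂} S₂` (`d₀ = 0`, `2d₁ < d₂ < 3d₁`, `S₁` symmetric,
`S₂` any real matrix) have NINE distinct positive det-roots.  Then for every `u > 0` and every unit bottom eigenvector `x` of `S₁ + u S₂`
(eigenvalue `t`, Rayleigh-minimal): `2u·σ_{S₂}(x) < −t` — the log-slope of the bottom eigen-branch exceeds `−1/2`, so (paper, report G16 §5) with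
`u = x^{d₂−d₁}`, `β = d₁/(d₂−d₁) ∈ (1/2,1)` the function `−u^β λ_min(S₁ + uS₂)` is strictly increasing and `λ_min` of the pencil vanishes exactly ONCE:
such a nine-row is never the pure-λ_min source of the flag ladder.  The sign inputs are `NineInertia.signs_chamber_II`. [folklore] -/
theorem chamberII_logSlope_of_nine (d : Fin 3 → ℕ) (S : Fin 3 → Matrix (Fin 3) (Fin 3) ℝ) (hS1 : (S 1).IsSymm)
    (h9 : 9 ≤ ((Matrix.det (∑ l, ((Polynomial.X : Polynomial ℝ) ^ d l) • (S l).map Polynomial.C)).roots.toFinset.filter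
      (fun t => 0 < t)).card)
    (h0 : d 0 = 0) (hS0 : S 0 = 1) (hIIa : 2 * d 1 < d 2) (hIIb : d 2 < 3 * d 1)
    {u t : ℝ} (hu : 0 < u) {x : Fin 3 → ℝ} (hx1 : x ⬝ᵥ x = 1)
    (heig : (S 1 + u • S 2) *ᵥ x = t • x)
    (hmin : ∀ y : Fin 3 → ℝ, t * (y ⬝ᵥ y) ≤ y ⬝ᵥ (S 1 + u • S 2) *ᵥ y) :
    2 * (u * (x ⬝ᵥ S 2 *ᵥ x)) < -t := by
  have hdet0 : 0 < (S 0).det := by rw [hS0, Matrix.det_one]; exact one_pos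
  obtain ⟨t1, t2, t3, t4, t5, -, -, -, -⟩ := signs_chamber_II d S h9 h0 hdet0 hIIa hIIb
  rw [hS0, Matrix.adjugate_one, Matrix.one_mul] at t1 t3
  rw [hS0, Matrix.mul_one] at t2
  rw [hS0, adjugate_polar_one_fin_three, Matrix.sub_mul, Matrix.smul_mul, Matrix.one_mul, Matrix.trace_sub,
    Matrix.trace_smul, smul_eq_mul] at t5
  exact chamberII_logSlope hS1 t4 t2 t1 t3 (by linarith) hu hx1 heig hmin

end NineInertia

end Summit.ValiantsHypothesis.ValiantsHypothesis.Theorems.LacunarySymmetroidMatrixDescartes.Census
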